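import Summits.CriticalPhenomena.PercolationContinuityZ3.Theorems.Transplant.SkelFrmBChoiceDefsT
import Summits.CriticalPhenomena.PercolationContinuityZ3.Theorems.Transplant.SkelFrmBParamsFineSize
import Summits.CriticalPhenomena.PercolationContinuityZ3.Theorems.Transplant.SkelNegBParamsSchedA
import Summits.CriticalPhenomena.PercolationContinuityZ3.Theorems.Transplant.SkelFrmBParamsSchedA
import HarnessLib

/-!
(R-40) `…T` TWIN (stmt-g21, 2026-08-23; ruling p3-g16 06:23:56Z, J18; lead g11 06:35:07Z: the choice function of record moves to `frmChoiceAllQ3T`): the twin of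
`SkelFrmBParamsSchedA` over the PER-AXIS-capped staggered cells `NegB.fcellsT : PCells2T` / the column slot `offNT` / the schedule `schedOfT` / the scheme `ΓQT` / the choices
`choiceAtQ3T` (SkelFrmBChoiceDefsT); statements and proofs VERBATIM with the S ↦ T tokens of record (stmt's table + hp-8 g42's registry renamedT.txt); the CELL-FREE
declarations of `SkelFrmBParamsSchedA` are NOT re-declared (they serve the T function as landed — `SkelFrmBParamsSchedA` is imported); NO landed file is edited.

# N2 (frames-only node `SamePDropOfSkeletonFrm₁`, OPEN) params column over `PlanarSkeletonFrm` — (ζ″) ledger, part Sched-A AT THE STAGGERED CENTRE: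
# the lattice record **`NegB.prFA : FinePrm`** (verbatim port of N1's `SkelNegBParamsSchedA` §2) and THE LINEAR COLUMN BOUND over the staggered cells
# `fcellsT` — **`offNT x ≤ cOffS·(|x₀| + |x₁|) + 1`** (the (F) binder `hoff`), `hoffNT_at` (the (F) binder `hoffN`), `prFA_room` (`hL0/hL1`)

N1's part Sched-A (p3xxxxx) had two halves: §1 the column slot `offNA w := NrepA (cen w) + 1` and the schedule `schedOfA` — under (R-22) these are READ AT THE STAGGERED
CENTRE and live in `SkelFrmBChoiceDefs` as `NegB.offNT` / `NegB.schedOfT` (ruling (R-31)); §2 the lattice record `prFA` (skeleton arithmetic only — ported verbatim here)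
and the linear column bound `offNA_le`, whose N1 proof used the EXACT representative at a cell centre (`rep₂ (cen x) = A·(x₀ n_L + x₁ v_L, x₀ h_L + x₁ v_β)`, `cen x`
being a lattice point of the fine map).  A staggered centre `cenS x = cen x + (c₁ x₁, c₀ x₀)` is NOT a lattice point, so the bound is re-proved from the ROUNDING-ERROR
form `TwoAxis.Para.rep₂_err` (`2·|c₀c₁·rep₂ᵢ − A·(…)| ≤ c₀c₁`) and `|cenS x|ⱼ ≤ 20·r_j·(|x₀| + |x₁|)` (creep `≤ cmax ≤ r_j`): `NrepA (cenS x) ≤ A·(L̂₁ + L̂₀)·(|x₀| + |x₁|)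
≤ 2·cOffA·(|x₀| + |x₁|)`, i.e. the N1 constant doubles (`cOffS := 2·cOffA`; the (F) files read the constant only through `hoff`/`hgapc`).
* §1 `prFA`, `prFA_fields`, `prFA_ψ`, `prFA_D`, `prFA_c_pos`, `prFA_c_eq`, `prFA_room` (N1 verbatim over `Frm`/`DataNS`);
* §2 `abs_rep₂_le_of_abs_le` (generic rounding bound), `abs_cenS_leT` (`|cenS x|ⱼ ≤ c_j·(|x₀|+|x₁|)`), **`NrepA_cenS_leT`**, `cOffS`, **`offNT_le`** (`hoff`), **`hoffNT_at`** (`hoffN`).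
builds on p205010 (kernel theorem, internal audit signed; external expert review pending) — nothing in this file uses p205010; NOTHING is claimed about the open node
`SamePDropOfSkeletonFrm₁` (`SamePDropOfSkeletonNeg₁` is CLOSED in the tree and untouched by this file).
Lane `prim-bschramm`, seat `prim-bschramm-stmt` (gen 20); helper file (`--supports stmt-CriticalPhenomena-4575 --as helper`); ledger HOME/prim-bschramm-stmt/FRM-PARAMS.md (t9), (r13-17).
[cite: KozmaNitzan2024, §4 Lemma 10 Step IV (pp. 20–21): the fine steps; p. 26 ((29): columns)] [cite: MartineauTassion2017, §4.3]
-/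

noncomputable section

open scoped Classical

namespace Summit.CriticalPhenomena.PercolationContinuityZ3.Theorems.Transplant

open Literature.Probability.Percolation Literature.Probability.LatticeModels SimpleGraph KNCells

namespace PlanarSkeletonFrm

namespace NegB

open SkelConc (Consts)
open BoxProdZ2 (ConcRadiiG)
open Literature.Probability.Percolation.KozmaNitzan.Cells (oth)
open Neg

section Sched

variable (κ : Consts) {V : Type} [DecidableEq V] [Countable V] {G : SimpleGraph V} [G.LocallyFinite] (Φ : PlanarSkeletonFrm G) (t : V)
  (p : unitInterval) (D : Skelφ.StepI.DataNS V) (g f : ℕ) (c : Fin 2 → ℕ)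

/-! ## §1 The lattice record of the (ζ′)/(ζ″) cells -/

-- (cell-free, not re-declared: `prFA` of SkelFrmBParamsSchedA)

-- (cell-free, not re-declared: `prFA_fields` of SkelFrmBParamsSchedA)

-- (cell-free, not re-declared: `prFA_ψ` of SkelFrmBParamsSchedA)

-- (cell-free, not re-declared: `prFA_D` of SkelFrmBParamsSchedA)

-- (cell-free, not re-declared: `prFA_c_pos` of SkelFrmBParamsSchedA)

-- (cell-free, not re-declared: `prFA_c_eq` of SkelFrmBParamsSchedA)

-- (cell-free, not re-declared: `prFA_c_eq_twenty_r` of SkelFrmBParamsSchedA)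

-- (cell-free, not re-declared: `prFA_room` of SkelFrmBParamsSchedA)

/-! ## §2 The linear column bound at the staggered centre -/

-- (cell-free, not re-declared: `abs_rep₂_le_of_abs_le` of SkelFrmBParamsSchedA)

/-- **The staggered centre grows linearly**: `|cenS x|ⱼ ≤ 20·r_j·(|x₀| + |x₁|)` (the creep FELT on coordinate `j` is `c (oth j) ≤ r_j`, the per-axis cap). [folklore] -/
theorem abs_cenS_leT (x : Site 2) (j : Fin 2) :
    |(fcellsT κ Φ t p D g f c).cenS x j| ≤ 20 * (((fcellsA κ Φ t p D g f).r j : ℕ) : ℤ) * (|x 0| + |x 1|) := by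
  set P := fcellsT κ Φ t p D g f c
  have key : ∀ a b ca r : ℤ, 0 ≤ r → 0 ≤ ca → ca ≤ r → |20 * r * a + ca * b| ≤ 20 * r * (|a| + |b|) := by
    intro a b ca r hr hca hcr
    have h1 : |20 * r * a + ca * b| ≤ 20 * r * |a| + ca * |b| := by
      calc |20 * r * a + ca * b| ≤ |20 * r * a| + |ca * b| := abs_add_le _ _
        _ = 20 * r * |a| + ca * |b| := by
            rw [abs_mul, abs_mul, abs_mul, abs_of_nonneg hr, abs_of_nonneg hca, abs_of_nonneg (by norm_num : (0 : ℤ) ≤ 20)]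
    nlinarith [abs_nonneg a, abs_nonneg b, mul_le_mul_of_nonneg_right hcr (abs_nonneg b)]
  have hr : ∀ k, (0 : ℤ) ≤ (((fcellsA κ Φ t p D g f).r k : ℕ) : ℤ) := fun k => by positivity
  have hc10 : P.c 1 ≤ (((fcellsA κ Φ t p D g f).r 0 : ℕ) : ℤ) := by
    have h := P.hcr 1; have e : oth (1 : Fin 2) = 0 := by decide
    rw [e] at h; exact h
  have hc01 : P.c 0 ≤ (((fcellsA κ Φ t p D g f).r 1 : ℕ) : ℤ) := by
    have h := P.hcr 0; have e : oth (0 : Fin 2) = 1 := by decide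
    rw [e] at h; exact h
  rw [PCells2T.cenS_apply]
  fin_cases j
  · show |20 * (((fcellsA κ Φ t p D g f).r 0 : ℕ) : ℤ) * x 0 + P.c 1 * x 1| ≤ 20 * (((fcellsA κ Φ t p D g f).r 0 : ℕ) : ℤ) * (|x 0| + |x 1|)
    exact key (x 0) (x 1) (P.c 1) _ (hr 0) (P.hc0 1) hc10
  · show |20 * (((fcellsA κ Φ t p D g f).r 1 : ℕ) : ℤ) * x 1 + P.c 0 * x 0| ≤ 20 * (((fcellsA κ Φ t p D g f).r 1 : ℕ) : ℤ) * (|x 0| + |x 1|)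
    rw [add_comm (|x 0|)]
    exact key (x 1) (x 0) (P.c 0) _ (hr 1) (P.hc0 0) hc01

/-- **`NrepA (cenS x) ≤ A·(L̂₁ + L̂₀)·(|x₀| + |x₁|)`** (rounding bound + the linear growth of the staggered centre). [this work] -/
theorem NrepA_cenS_leT (x : Site 2) :
    (NrepA κ Φ t p D g f ((fcellsT κ Φ t p D g f c).cenS x) : ℤ) ≤
      Aof κ * (Skelφ.NegPrm.L1hat (nL κ Φ t p D g f) (hL κ Φ t p D g f) +
        Skelφ.NegPrm.L0hat (nL κ Φ t p D g f) (hL κ Φ t p D g f) (ℓL κ Φ t p D g f) (vL κ Φ t p D g f)) * (|x 0| + |x 1|) := by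
  have hA : 0 < Aof κ := (Aof_pos κ).1
  have hz0 := abs_cenS_leT κ Φ t p D g f c x 0
  have hz1 := abs_cenS_leT κ Φ t p D g f c x 1
  have e0 : 20 * (((fcellsA κ Φ t p D g f).r 0 : ℕ) : ℤ) = 20 * ((fcellsA κ Φ t p D g f).K : ℤ) * (((fcellsA κ Φ t p D g f).s 0 : ℕ) : ℤ) := by
    simp [PCells2.r]; ring
  have e1 : 20 * (((fcellsA κ Φ t p D g f).r 1 : ℕ) : ℤ) = 20 * ((fcellsA κ Φ t p D g f).K : ℤ) * (((fcellsA κ Φ t p D g f).s 1 : ℕ) : ℤ) := by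
    simp [PCells2.r]; ring
  rw [e0] at hz0; rw [e1] at hz1
  obtain ⟨b0, b1⟩ := abs_rep₂_le_of_abs_le (A := Aof κ) (n := (nL κ Φ t p D g f : ℤ)) (h := hL κ Φ t p D g f) (vα := vL κ Φ t p D g f)
    (vβ := vβL κ Φ t p D g f) (cA_pos κ Φ t p D g f 0) (cA_pos κ Φ t p D g f 1) hz0 hz1
  unfold NrepA
  push_cast
  rw [abs_of_pos hA] at b0 b1
  unfold Skelφ.NegPrm.L1hat Skelφ.NegPrm.L0hat
  unfold vβL at b0 b1 ⊢
  have hn : |(nL κ Φ t p D g f : ℤ)| = nL κ Φ t p D g f := abs_of_nonneg (by positivity)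
  rw [hn] at b0
  have e : Aof κ * (((nL κ Φ t p D g f : ℤ) + |vL κ Φ t p D g f|)) * (|x 0| + |x 1|) +
      Aof κ * ((|hL κ Φ t p D g f| + |Skelφ.NegPrm.vβOf (nL κ Φ t p D g f) (hL κ Φ t p D g f) (ℓL κ Φ t p D g f) (vL κ Φ t p D g f)|)) * (|x 0| + |x 1|) =
      Aof κ * (((nL κ Φ t p D g f : ℤ) + |hL κ Φ t p D g f|) +
        (|Skelφ.NegPrm.vβOf (nL κ Φ t p D g f) (hL κ Φ t p D g f) (ℓL κ Φ t p D g f) (vL κ Φ t p D g f)| + |vL κ Φ t p D g f|)) * (|x 0| + |x 1|) := by ring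
  linarith

-- (cell-free, not re-declared: `cOffS` of SkelFrmBParamsSchedA)

-- (cell-free, not re-declared: `cOffS_int` of SkelFrmBParamsSchedA)

/-- **THE LINEAR COLUMN BOUND AT THE STAGGERED CENTRE (the (F) binder `hoff`)**: `offNT x ≤ cOffS·(|x₀| + |x₁|) + 1`, under the numeric long clause and
`|h_L| ≤ 10·n_L`, for EVERY creep value. [this work] -/
theorem offNT_le (hN : EqNumL κ Φ t p D g f) (hκ : (hL κ Φ t p D g f).natAbs ≤ 10 * nL κ Φ t p D g f) (x : Site 2) :
    offNT κ Φ t p D g f c x ≤ cOffS κ Φ t p D g f * ((x 0).natAbs + (x 1).natAbs) + 1 := by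
  have h := NrepA_cenS_leT κ Φ t p D g f c x
  have hL0 := L0hat_le κ Φ t p D g f hN hκ
  have hL1 := L1hat_le κ Φ t p D g f hκ
  have hA : 0 < Aof κ := (Aof_pos κ).1
  have hℓ0 : (0 : ℤ) ≤ ℓL κ Φ t p D g f := by positivity
  have hn0 : (0 : ℤ) ≤ nL κ Φ t p D g f := by positivity
  have hx : (0 : ℤ) ≤ |x 0| + |x 1| := by positivity
  have hsum : Skelφ.NegPrm.L1hat (nL κ Φ t p D g f) (hL κ Φ t p D g f) +
      Skelφ.NegPrm.L0hat (nL κ Φ t p D g f) (hL κ Φ t p D g f) (ℓL κ Φ t p D g f) (vL κ Φ t p D g f) ≤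
      2 * ((ℓL κ Φ t p D g f : ℤ) + 21 * nL κ Φ t p D g f + 1) := by linarith
  have key : (NrepA κ Φ t p D g f ((fcellsT κ Φ t p D g f c).cenS x) : ℤ) ≤ 2 * (Aof κ * ((ℓL κ Φ t p D g f : ℤ) + 21 * nL κ Φ t p D g f + 1)) * (|x 0| + |x 1|) := by
    have s := mul_le_mul_of_nonneg_right (mul_le_mul_of_nonneg_left hsum hA.le) hx
    have e : Aof κ * (2 * ((ℓL κ Φ t p D g f : ℤ) + 21 * nL κ Φ t p D g f + 1)) * (|x 0| + |x 1|) =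
        2 * (Aof κ * ((ℓL κ Φ t p D g f : ℤ) + 21 * nL κ Φ t p D g f + 1)) * (|x 0| + |x 1|) := by ring
    linarith
  unfold offNT
  have : (NrepA κ Φ t p D g f ((fcellsT κ Φ t p D g f c).cenS x) : ℤ) ≤ ((cOffS κ Φ t p D g f * ((x 0).natAbs + (x 1).natAbs) : ℕ) : ℤ) := by
    push_cast; rw [cOffS_int]; exact key
  have := Int.ofNat_le.1 this
  omega

/-- **The (F) binder `hoffN` at the staggered centre**: `‖rep₂ prFA… (cenS x)‖₁ + 1 ≤ offNT x` (by definition of `offNT`). [folklore] -/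
theorem hoffNT_at (x : Site 2) :
    (TwoAxis.Para.rep₂ (prFA κ Φ t p D g f).A (prFA κ Φ t p D g f).n (prFA κ Φ t p D g f).h (prFA κ Φ t p D g f).vα (prFA κ Φ t p D g f).vβ (prFA κ Φ t p D g f).c₀
          (prFA κ Φ t p D g f).c₁ ((fcellsT κ Φ t p D g f c).cenS x) 0).natAbs +
        (TwoAxis.Para.rep₂ (prFA κ Φ t p D g f).A (prFA κ Φ t p D g f).n (prFA κ Φ t p D g f).h (prFA κ Φ t p D g f).vα (prFA κ Φ t p D g f).vβ (prFA κ Φ t p D g f).c₀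
          (prFA κ Φ t p D g f).c₁ ((fcellsT κ Φ t p D g f c).cenS x) 1).natAbs + 1 ≤ offNT κ Φ t p D g f c x :=
  le_rfl

end Sched

end NegB

end PlanarSkeletonFrm

end Summit.CriticalPhenomena.PercolationContinuityZ3.Theorems.Transplant

end
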